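import Summits.HodgeConjecture.CorCM.TwoGroupCentralElementarySplitting
import Summits.HodgeConjecture.CorCM.CentralInvolutionComplement
import Summits.HodgeConjecture.CorCM.GaloisNonNormalPrimeOrder
import HarnessLib

/-!
# GOOD Galois CM fields of `2`-power degree whose order-`4` automorphisms square to complex conjugation: the Galois group SPLITS as
# (cyclic or generalised quaternion) × (elementary abelian)

COR-CM (cell `pub-hodgecm2`), binder seat b04 (gen 34), count-neutral own lane «Galois-CM-type classification».  KERNEL ONLY:
theorems; no definition, no named fact, no `sorry`.  `HC_CM` is neither used nor claimed.  The Galois dress of gen 34's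
`CorCM/TwoGroupCentralElementarySplitting`: for a Galois CM field `K` of degree `2^n ≥ 64` all of whose primitive CM types are
nondegenerate (GOOD), every involution of `G = Gal(K/ℚ)` is central (gen 33); so if (H2) every `σ ∈ G` with `σ⁴ = 1` has
`σ² ∈ {1, c}` (`c` = complex conjugation), then with `E` a complement of `⟨c⟩` in the involutions
(`CorCM/CentralInvolutionComplement`) the splitting theorem gives **`G = H × E`, `E` central elementary abelian, `c ∈ H`, `H` cyclic or
generalised quaternion**.  The conjectured classification of GOOD `2`-power Galois CM fields (A7-JUNCTION gen-33 §D(2): `C`, `Q`,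
`C × C₂`, `Q × C₂`) is thereby reduced to (H2) plus `|E| ≤ 2` (the latter is the abelian classification of gens 15–16 for `H` cyclic
and gen 30's `× C₂²` theorem for `H` quaternion — to be wired by a successor; the former, «GOOD ⟹ (H2)», is the one remaining
piece of mathematics: an automorphism of order `4` whose square is a central involution `≠ c` should make the field BAD).

* `exists_isComplement'_of_forall_isNondegenerate` — the structure theorem above.

## References

* [Rotman1995] J. J. Rotman, *An Introduction to the Theory of Groups*, 4th ed., GTM 148, Springer 1995, Thm. 5.46.
* [Shimura1998] G. Shimura, *Abelian Varieties with Complex Multiplication and Modular Functions*, §8.2 Prop. 26, §18.2.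
-/

noncomputable section

open CategoryTheory CategoryTheory.Limits NumberField
open scoped BigOperators

namespace Summit.HodgeConjecture.CorCM.GaloisModels

open Literature.NumberTheory.ComplexMultiplication
open Literature.AlgebraicGeometry.Motives (AbelianVariety CMType)
open Literature.AlgebraicGeometry.HodgeTheory
open Literature.AlgebraicGeometry.Pohlmann1968
open Summit.HodgeConjecture.CorCM.GaloisRank

variable {K : Type} [Field K] [NumberField K] [IsCMField K] [IsGalois ℚ K]

/-- **GOOD + (H2) ⟹ `Gal(K/ℚ) = H × E` with `H ∋ c` cyclic or generalised quaternion and `E` central elementary abelian.**  `K` Galois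
CM of degree `2^n`, `n ≥ 6`, every primitive CM type nondegenerate, and every `σ ∈ Gal(K/ℚ)` with `σ⁴ = 1` satisfying
`σ² ∈ {1, c}` (`c` = complex conjugation).  Then there are subgroups `H, E ≤ Gal(K/ℚ)` with `H.IsComplement' E` (every element is
uniquely `h e`), `E` central of exponent `2` with `c ∉ E`, `c ∈ H`, `|H| = 2^k`, and `H` cyclic or `H ≃* QuaternionGroup (2^(k-2))`.
[cite: Rotman1995, Thm. 5.46] [cite: Shimura1998, §8.2 Prop. 26 and §18.2] -/
theorem exists_isComplement'_of_forall_isNondegenerate {n : ℕ} (hdeg : Module.finrank ℚ K = 2 ^ n) (hn : 6 ≤ n)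
    (hgood : ∀ (Φ : CMType K) (φ : K →+* ℂ), IsPrimitive (ℂ ≃+* ℂ) Φ.1 φ → IsNondegenerate Φ)
    (hsq : ∀ σ : K ≃ₐ[ℚ] K, σ ^ 4 = 1 → σ * σ = 1 ∨ σ * σ = (IsCMField.complexConj K).restrictScalars ℚ) :
    ∃ (H E : Subgroup (K ≃ₐ[ℚ] K)) (k : ℕ), H.IsComplement' E ∧ (IsCMField.complexConj K).restrictScalars ℚ ∈ H ∧
      (IsCMField.complexConj K).restrictScalars ℚ ∉ E ∧ (∀ e ∈ E, e * e = 1 ∧ ∀ g : K ≃ₐ[ℚ] K, g * e = e * g) ∧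
      Nat.card H = 2 ^ k ∧ (IsCyclic H ∨ (3 ≤ k ∧ Nonempty (H ≃* QuaternionGroup (2 ^ (k - 2))))) := by
  classical
  set c := (IsCMField.complexConj K).restrictScalars ℚ with hc
  have hcc : c * c = 1 := model_complexConj_mul_self (MulEquiv.refl (K ≃ₐ[ℚ] K)) (by simp [hc])
  have hc1 : c ≠ 1 := model_complexConj_ne_one (MulEquiv.refl (K ≃ₐ[ℚ] K)) (by simp [hc])
  have hccen : ∀ g : K ≃ₐ[ℚ] K, g * c = c * g := fun g =>
    (model_complexConj_comm (MulEquiv.refl (K ≃ₐ[ℚ] K)) (by simp [hc]) g).symm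
  have h52 : 52 ≤ Module.finrank ℚ K := by
    rw [hdeg]
    calc (52 : ℕ) ≤ 2 ^ 6 := by norm_num
      _ ≤ 2 ^ n := Nat.pow_le_pow_right (by norm_num) hn
  have hcard : Nat.card (K ≃ₐ[ℚ] K) = 2 ^ n := by
    rw [Nat.card_eq_fintype_card, card_model_eq_finrank (MulEquiv.refl (K ≃ₐ[ℚ] K)), hdeg]
  obtain ⟨E, hcE, hE, hEmax⟩ := UniqueInvolution.exists_complement_avoiding c hc1
  have hΩ : ∀ s : K ≃ₐ[ℚ] K, s * s = 1 → s ∈ E ∨ c * s ∈ E := fun s hs =>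
    hEmax s hs fun g => commute_of_involution_of_forall_isNondegenerate_of_le h52 hgood s hs g
  obtain ⟨H, k, hHE, hcH, hHcard, hstruct⟩ :=
    UniqueInvolution.exists_isComplement'_of_pow_four hcard hcc hccen E hcE hE hΩ hsq
  exact ⟨H, E, k, hHE, hcH, hcE, hE, hHcard, hstruct⟩

end Summit.HodgeConjecture.CorCM.GaloisModels
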